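/-
Copyright: the b2b-balaban T⁴-continuum CRUX team, row NE7b, leaf lineage `t4-ne7b-formalise-leaf-02` (gen 132). Project licence.
-/
import Literature.MathematicalPhysics.QuantumFieldTheory.Balaban1983to89.B7Prop3GeneralLinearBound
import Literature.MathematicalPhysics.QuantumFieldTheory.Balaban1983to89.B7LocalityGeneral

/-!
# THE (R-M) LETTER AT ONE STEP, BY NAME: the remainder `E = L(Q(V₀)A)_c − L(Q₀A)_c` of [B7]'s linearised one-step average against
# its main term (125) (the transported straight-segment average — the memo's `M_k` at `k = 1`) is LOCAL in the field (bonds of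
# `B(c₋) ∪ B(c₊)` only) and therefore `ℓ²`-SMALL: `‖E(c)‖ ≤ 50(d+1)·ε·L·max_{b ⊂ B(c₋)∪B(c₊)} ‖A_b‖` from the tree's SUP-norm (126),
# `‖E(c)‖² ≤ (50(d+1)εL)²·Σ_{b ⊂ B(c₋)∪B(c₊)} ‖A_b‖²`, and summed over any finite family of coarse bonds of the `L`-lattice (box multiplicity
# `ν = 2d` BY NAME): `Σ_c ‖E(c)‖² ≤ (50(d+1)εL)²·2d·Σ_b ‖A_b‖²` (row NE7b, node U5c; the (h1) slot of print's `γ₀` assembly, `SectE-interface-proof.md` §5.3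
# reading (R-M) «`Q_k(U) = M_k + E_k`, `Σ_c|(E_kA)(c)|² ≤ c_E²ε_F²‖A‖²`» — its `k = 1` instance as a theorem of the tree's [B7] modules;
# consumer: `…AveragedCurlFormSplit`'s `hE`)

Cell `pub-balaban`, sub-cell `t4`, spine estimate NE7b (`T4WeightBudget.RelWeightBound`; the cell's OWN estimate — NOT PRINTED in
[Bałaban 1983–89], NOT PROVED).  Crux-route work under `Spine/NE7b/` by the row's E-side ∕ key-readings ∕ lattice-geometry leaf lineage; NOTHING
of Bałaban's is asserted beyond what the imported Literature modules prove; no `T4Continuum/Support` leaf typed; no `def`, no notation; zero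
`sorry`.  Imports (hub oleans present), REUSED BY NAME and not restated: `Literature.….B7Prop3GeneralLinearBound` (NE7c round-2 leaf-05:
`norm_linQcov_sub_main_le` — (126) with the `O(1)` explicit, SUP-norm in the field: `‖L(Q(V₀)A)_c − L·(Q₀A)_c‖ ≤ 50(d+1)·ε·L·|A|` for
`|A_b| ≤ |A|` EVERYWHERE) and `Literature.….B7LocalityGeneral` (lit-balaban r20: `Qcov_congr` — the one-step map (121) depends on the bonds
of `B(c₋) ∪ B(c₊)` only); through them `B7Prop3GeneralLinear` (`Qcov`, `Q0cov` = (125), `linQcov` = «`L(Q(V₀)A)_c`» as the `t`-derivative of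
(121)), `B7Prop3GeneralRotated.tsum` (= `(R_{0,y}A)(Γ)`), `B7Prop1Local` (`InBox`, `AgreeOn`, `bondHi`), `B7Prop5Flat` (`bondsIn`, `restr`,
`insCfg`-restriction `agreeOn_insCfg_restr`, and the block count `mem_nearBonds_of_bondIn` ∕ `card_nearBonds_le`),
`B7Prop2Explicit.norm_Wcx_sub_one_le` ((109) ⟹ block-loop regularity).

WHY (located).  `SectE-interface-proof.md` §5.3 (R-M), the note's ONE delicate identification (§8.1: «A hostile reader should attack (R-M)
first»): «`Q_k(U) = M_k + E_k`, `Σ_{c∈Λ_k}|(E_kA)(c)|² ≤ c_E²ε_F²‖A‖²_{L²(Ω_k)}`, `c_E = c_E(d,L)` uniform in `k`.  Evidence: B7 (125) (the linear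
one-step average is the transported straight-segment average), (134), and (139)–(143)».  At ONE step (`k = 1`) the tree already holds the
two printed facts this needs, in SUP-norm and as a locality statement; THIS FILE turns them into the `ℓ²` letter the (h1) slot consumes
(`…AveragedCurlFormSplit.sum_sq_remainder_le`'s `hE : Σ_c sz(EA) c² ≤ c_E·NΩ A`), at `k = 1`, with
`c_E = (50(d+1)εL)²·2d` before the `L^{−(d+1)}` ∕ `η^d` normalisations (`ε` = the block-loop regularity `‖W_x(V₀) − 1‖ ≤ ε ≤ ⅛`;
`= 16(d+1)(d+4)L²α₀` under the plaquette regularity (109), §4).  The `k`-uniform statement for the COMPOSED operator (B7 (134), (142)–(143))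
is NOT here and NOT in the tree.

WHAT IS PROVED ([folklore] bookkeeping over the tree's [B7] theorems; `𝔸` a complete normed `ℂ`-algebra with `‖1‖ = 1`, sites `ℤ^d`,
`c = ⟨q, q + Le_κ⟩` an `L`-bond with box `[q, bondHi L q κ] = B(c₋) ∪ B(c₊)`, background `V₀` with values in the unit-ball units `U1 𝔸`):
* §1 LOCALITY IN THE FIELD at fixed background: `tsum_seg_congr` (`(R_{0,y}A)([p, p + ne_κ])` depends on `A` on the segment's bonds —
  the covariant twin of `B7Prop5Flat.asum_seg_congr`), **`Q0cov_congr_right`** (the main term (125) depends on `A|_{B(c₋)∪B(c₊)}`),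
  **`linQcov_congr_right`** (so does `L(Q(V₀)A)_c` — `B7LocalityGeneral.Qcov_congr` BY NAME under the `t`-derivative).
* §2 **`norm_remainder_le_local`** — (126)'s remainder bound with the LOCAL sup: `‖A_b‖ ≤ a` on the bonds of `B(c₋) ∪ B(c₊)` only ⊢
  `‖L(Q(V₀)A)_c − L·(Q₀A)_c‖ ≤ 50(d+1)·ε·L·a` (`norm_linQcov_sub_main_le` BY NAME applied to the box-restricted field
  `insCfg (bondsIn …) (restr … A)`, then §1).
* §3 **`normSq_remainder_le_local`** — the `ℓ²` form at one coarse bond: `‖E(c)‖² ≤ (50(d+1)εL)²·Σ_{b ∈ bondsIn q (bondHi L q κ)} ‖A_b‖²`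
  (`a := √Σ`); **`sum_normSq_remainder_le`** — over a finite family `Λ` of coarse bonds whose boxes' bond sets have multiplicity `≤ ν` inside
  a finite bond set `T`: `Σ_{c∈Λ} ‖E(c)‖² ≤ (50(d+1)εL)²·ν·Σ_{b∈T} ‖A_b‖²` — the (R-M) letter's SHAPE at `k = 1` (`sum_sum_filter_le`: the
  double count).
* §4 `norm_remainder_le_local_of_plaquettes` — §2 with `ε := 16(d+1)(d+4)L²α₀` from the plaquette regularity `‖V₀(∂p) − 1‖ ≤ α₀` (109)
  (`B7Prop2Explicit.norm_Wcx_sub_one_le` BY NAME, as `B7Prop3GeneralLinearBound.norm_linQcov_le_of_plaquettes` does for (126)).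
* §5 `bondHi_loK_one`, **`card_filter_box_le`** (`ν = 2d` for the coarse bonds `⟨y, y + e_κ⟩` of the `L`-lattice — `B7Prop5Flat.mem_nearBonds_of_bondIn`
  ∕ `card_nearBonds_le` BY NAME, print's `2d` of (142)), **`sum_normSq_remainder_le_lattice`** — THE LETTER AT `k = 1` BY VALUE up to the
  normalisations: `Σ_{c∈Λ} ‖E(c)‖² ≤ (50(d+1)εL)²·2d·Σ_{b∈T} ‖A_b‖²`.

NOT HERE (honest): the `k`-step ∕ `k`-uniform (R-M) for the COMPOSED average `Q_k(U) = Q(Ū^{k−1})⋯Q(U)` (B7 (134), (139)–(143): the tree's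
`B7Prop4General*` carry one-step inputs as hypotheses; the identification of the composed main part with the memo's `M_k` up to `O(ε_F)`
transports is the UNPROVED half of (R-M)); the Jensen∕`Q″` route of the memo (which gives `c_E` without the factor `L^d` hidden in
`Σ_{b ⊂ box}` vs `max`); the torus (the [B7] modules are on `ℤ^d`; descent = `B7AvgPeriodicity`); the normalisations `L^{−(d+1)}` ∕ `η^d`
((A3) ∕ (A1c), NC-NE7b-α UNRULED); anything of Bałaban's beyond the imported modules.  BY-NAME EFFECT ON THE WALL: NONE (one displayed
letter of the (h1) slot, (R-M), now has its `k = 1` instance as a theorem of the tree, constant by value; the wall is (R2)).  NE7b NOT PRINTED ∕ NOT PROVED;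
spine PROVED 0∕9; rung (B)+1 on a FINITE torus — NOT infinite volume, NOT the mass gap, NOT Clay.
HONEST DEPENDENCY: continuum YM on T⁴ ⇐ BetaPertH ∧ nine spine estimates (0/9 proved); BetaPertH ⇐ (D1) ∧ (D4) ∧ CAP+tail; G-an2-4 gates
asym, D1 and NE2/3/4.
-/

set_option autoImplicit false

noncomputable section

open scoped BigOperators
open Finset
open Literature.MathematicalPhysics.QuantumFieldTheory.Balaban1983to89
open Literature.MathematicalPhysics.QuantumFieldTheory.Balaban1983to89.B7Prop1Explicit
  (Site Letter e hol seg treeWord boxVec stepHol Wcx U1 plaqWord seg_natCast)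
open Literature.MathematicalPhysics.QuantumFieldTheory.Balaban1983to89.B7Prop1Local
  (InBox AgreeOn bondHi inBox_add_e add_zsmul_e_apply add_e_apply)
open Literature.MathematicalPhysics.QuantumFieldTheory.Balaban1983to89.B7Prop5Flat
  (BondIn bondsIn restr mem_bondsIn agreeOn_insCfg_restr)
open Literature.MathematicalPhysics.QuantumFieldTheory.Balaban1983to89.B7Prop3Flat (insCfg)
open Literature.MathematicalPhysics.QuantumFieldTheory.Balaban1983to89.B7Prop3GeneralRotated (tsum tstep tsum_cons tsum_nil)
open Literature.MathematicalPhysics.QuantumFieldTheory.Balaban1983to89.B7Prop3GeneralLinear (Qcov Q0cov linQcov)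
open Literature.MathematicalPhysics.QuantumFieldTheory.Balaban1983to89.B7Prop3GeneralLinearBound (norm_linQcov_sub_main_le)
open Literature.MathematicalPhysics.QuantumFieldTheory.Balaban1983to89.B7LocalityGeneral (Qcov_congr)

namespace Summit.QuantumFields.BalabanUV.T4Continuum.NE7b.OneStepAveragingRemainder

variable {d : ℕ}
variable {𝔸 : Type*} [NormedRing 𝔸] [NormedAlgebra ℂ 𝔸] [NormOneClass 𝔸] [CompleteSpace 𝔸]

/-! ## §1 Locality in the field at fixed background: `(R_{0,y}A)(segment)`, the main term (125), and `L(Q(V₀)A)_c` -/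

section Locality

variable (V₀ : Site d → Fin d → 𝔸ˣ) {lo hi : Site d} {A A' : Site d → Fin d → 𝔸}

omit [NormedAlgebra ℂ 𝔸] [NormOneClass 𝔸] [CompleteSpace 𝔸] in
/-- **LOCALITY OF THE ROTATED PATH SUM ALONG A STRAIGHT SEGMENT**: two fields agreeing on the bonds of a box containing `p` and `p + ne_κ`
give the same `(R_{0,p}A)([p, p + ne_κ])` at a fixed background (the covariant twin of `B7Prop5Flat.asum_seg_congr`; pattern of
`B7Prop1Local.hol_seg_congr`). [folklore] -/
theorem tsum_seg_congr (h : AgreeOn lo hi A A') (κ : Fin d) :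
    ∀ (n : ℕ) (p : Site d), InBox lo hi p → InBox lo hi (p + (n : ℤ) • e κ) →
      tsum V₀ A p (seg κ n) = tsum V₀ A' p (seg κ n)
  | 0, p, _, _ => by simp
  | n + 1, p, hp, hpn => by
    have hpe : InBox lo hi (p + e κ) := inBox_add_e hp hpn
    have hpn' : InBox lo hi (p + e κ + (n : ℤ) • e κ) := by
      have he : p + e κ + (n : ℤ) • e κ = p + ((n + 1 : ℕ) : ℤ) • e κ := by
        push_cast; rw [add_smul, one_smul]; abel
      rw [he]; exact hpn
    rw [seg_natCast, List.replicate_succ, tsum_cons, tsum_cons, Letter.vec_true, ← seg_natCast,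
      tsum_seg_congr h κ n (p + e κ) hpe hpn']
    simp only [tstep, if_true, h p κ hp hpe]

omit [NormOneClass 𝔸] [CompleteSpace 𝔸] in
/-- **LOCALITY OF THE MAIN TERM (125)** `(Q₀A)_c = Σ_{x∈B(c₋)} L^{−(d+1)} R(V₀(Γ_{c₋,x}))(R_{0,x}A)([x, x′])` in the field: it depends on `A`
only through the bonds of `B(c₋) ∪ B(c₊) = [q, bondHi L q κ]` (the segments `[x, x + Le_κ]`, `x ∈ B(c₋)`, lie in the box). [folklore] -/
theorem Q0cov_congr_right (L : ℕ) (q : Site d) (κ : Fin d) (h : AgreeOn q (bondHi L q κ) A A') :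
    Q0cov L V₀ A q κ = Q0cov L V₀ A' q κ := by
  unfold Q0cov
  refine Finset.sum_congr rfl fun r _ => ?_
  have hr : ∀ i, 0 ≤ boxVec L r i ∧ boxVec L r i + 1 ≤ L := fun i =>
    ⟨by simp [boxVec], by have := (r i).isLt; simp only [boxVec]; omega⟩
  have hqr : InBox q (bondHi L q κ) (q + boxVec L r) := fun i => by
    have := hr i; simp only [bondHi, Pi.add_apply]; split_ifs <;> omega
  have hqrL : InBox q (bondHi L q κ) (q + boxVec L r + (L : ℤ) • e κ) := fun i => by
    have := hr i
    simp only [bondHi, Pi.add_apply, Pi.smul_apply, smul_eq_mul, B7Prop1Explicit.e_apply, mul_ite, mul_one, mul_zero]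
    split_ifs <;> omega
  rw [tsum_seg_congr V₀ h κ L (q + boxVec L r) hqr hqrL]

omit [NormOneClass 𝔸] in
/-- **LOCALITY OF `L(Q(V₀)A)_c`** (the `t`-derivative at `0` of the one-step map (121) along `t ↦ tA`) in the field: `B7LocalityGeneral.Qcov_congr`
BY NAME for every `t`. [folklore] -/
theorem linQcov_congr_right (L : ℕ) (hL : 1 ≤ L) (q : Site d) (κ : Fin d) (h : AgreeOn q (bondHi L q κ) A A') :
    linQcov L V₀ A q κ = linQcov L V₀ A' q κ := by
  unfold linQcov
  have hfun : (fun t : ℂ => Qcov L V₀ (t • A) q κ) = fun t : ℂ => Qcov L V₀ (t • A') q κ := by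
    funext t
    exact Qcov_congr L hL q κ (V₀ := V₀) (V₀' := V₀) (fun _ _ _ _ => rfl)
      (fun x κ' hx hx' => by simp only [Pi.smul_apply, h x κ' hx hx'])
  rw [hfun]

end Locality

/-! ## §2 (126)'s remainder with the LOCAL sup of the field -/

section LocalSup

variable (L : ℕ) {V₀ : Site d → Fin d → 𝔸ˣ} (hV₀ : ∀ x κ, V₀ x κ ∈ U1 𝔸) (hL : 1 ≤ L) (q : Site d) (κ : Fin d)
  {ε : ℝ} (hε0 : 0 ≤ ε) (hε : ε ≤ 1 / 8)
  (hW : ∀ r : Fin d → Fin L, ‖((Wcx L V₀ q κ (boxVec L r) : 𝔸ˣ) : 𝔸) - 1‖ ≤ ε)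

include hV₀ hL hε0 hε hW in
/-- **THE ONE-STEP REMAINDER IS BOUNDED BY THE FIELD ON THE BOX** — (126) (`B7Prop3GeneralLinearBound.norm_linQcov_sub_main_le`:
`‖L(Q(V₀)A)_c − L·(Q₀A)_c‖ ≤ 50(d+1)·ε·L·|A|` for a GLOBAL bound `|A_b| ≤ |A|`) with the hypothesis localised to the bonds of `B(c₋) ∪ B(c₊)`:
`‖A_b‖ ≤ a` there ⊢ the same bound — apply (126) to the box-restricted field (`= A` on the box, `0` elsewhere) and use §1. [folklore] -/
theorem norm_remainder_le_local (A : Site d → Fin d → 𝔸) {a : ℝ} (ha : 0 ≤ a)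
    (hA : ∀ x κ', InBox q (bondHi L q κ) x → InBox q (bondHi L q κ) (x + e κ') → ‖A x κ'‖ ≤ a) :
    ‖linQcov L V₀ A q κ - (L : ℝ) • Q0cov L V₀ A q κ‖ ≤ 50 * (d + 1) * ε * L * a := by
  set A' : Site d → Fin d → 𝔸 := insCfg (bondsIn q (bondHi L q κ)) (restr (bondsIn q (bondHi L q κ)) A) with hA'def
  have hagree : AgreeOn q (bondHi L q κ) A A' := agreeOn_insCfg_restr q (bondHi L q κ) A
  have hA' : ∀ x κ', ‖A' x κ'‖ ≤ a := by
    intro x κ'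
    by_cases hmem : (x, κ') ∈ bondsIn q (bondHi L q κ)
    · have hb := (mem_bondsIn.mp hmem)
      rw [← hagree x κ' hb.1 hb.2]
      exact hA x κ' hb.1 hb.2
    · have : A' x κ' = 0 := by simp [hA'def, insCfg, hmem]
      rw [this, norm_zero]; exact ha
  rw [linQcov_congr_right V₀ L hL q κ hagree, Q0cov_congr_right V₀ L q κ hagree]
  exact norm_linQcov_sub_main_le L hV₀ ha hA' hL q κ hε0 hε hW

/-! ## §3 The `ℓ²` forms: one coarse bond, and a finite family with a multiplicity letter -/

include hV₀ hL hε0 hε hW in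
/-- **THE `ℓ²` FORM AT ONE COARSE BOND**: `‖L(Q(V₀)A)_c − L·(Q₀A)_c‖² ≤ (50(d+1)εL)²·Σ_{b ∈ bondsIn q (bondHi L q κ)} ‖A_b‖²` (§2 with
`a := √Σ`, every `‖A_b‖` on the box being `≤ √Σ`). [folklore] -/
theorem normSq_remainder_le_local (A : Site d → Fin d → 𝔸) :
    ‖linQcov L V₀ A q κ - (L : ℝ) • Q0cov L V₀ A q κ‖ ^ 2
      ≤ (50 * (d + 1) * ε * L) ^ 2 * ∑ b ∈ bondsIn q (bondHi L q κ), ‖A b.1 b.2‖ ^ 2 := by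
  set s : ℝ := ∑ b ∈ bondsIn q (bondHi L q κ), ‖A b.1 b.2‖ ^ 2 with hs
  have hs0 : 0 ≤ s := Finset.sum_nonneg fun b _ => sq_nonneg _
  have hA : ∀ x κ', InBox q (bondHi L q κ) x → InBox q (bondHi L q κ) (x + e κ') → ‖A x κ'‖ ≤ Real.sqrt s := by
    intro x κ' hx hx'
    have hmem : (x, κ') ∈ bondsIn q (bondHi L q κ) := mem_bondsIn.mpr ⟨hx, hx'⟩
    have hle : ‖A x κ'‖ ^ 2 ≤ s := Finset.single_le_sum (f := fun b : Site d × Fin d => ‖A b.1 b.2‖ ^ 2)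
      (fun b _ => sq_nonneg _) hmem
    exact Real.le_sqrt_of_sq_le hle
  have h := norm_remainder_le_local L hV₀ hL q κ hε0 hε hW A (Real.sqrt_nonneg s) hA
  have hC : 0 ≤ 50 * (d + 1) * ε * L := by positivity
  calc ‖linQcov L V₀ A q κ - (L : ℝ) • Q0cov L V₀ A q κ‖ ^ 2 ≤ (50 * (d + 1) * ε * L * Real.sqrt s) ^ 2 :=
        pow_le_pow_left₀ (norm_nonneg _) h 2
    _ = (50 * (d + 1) * ε * L) ^ 2 * s := by rw [mul_pow, Real.sq_sqrt hs0]

end LocalSup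

section Family

/-- **THE DOUBLE COUNT**: for `g ≥ 0` on a finite bond set `T` containing every `S c`, `c ∈ Λ`, with `#{c ∈ Λ : b ∈ S c} ≤ ν` for `b ∈ T`:
`Σ_{c∈Λ} Σ_{b∈S c} g b ≤ ν·Σ_{b∈T} g b`. [folklore] -/
theorem sum_sum_filter_le {ι β : Type*} [DecidableEq β] (Λ : Finset ι) (S : ι → Finset β) (T : Finset β)
    (hST : ∀ c ∈ Λ, S c ⊆ T) {ν : ℕ} (hν : ∀ b ∈ T, (Λ.filter fun c => b ∈ S c).card ≤ ν)
    (g : β → ℝ) (hg : ∀ b ∈ T, 0 ≤ g b) :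
    ∑ c ∈ Λ, ∑ b ∈ S c, g b ≤ ν * ∑ b ∈ T, g b := by
  have h1 : ∀ c ∈ Λ, ∑ b ∈ S c, g b = ∑ b ∈ T, if b ∈ S c then g b else 0 := by
    intro c hc
    rw [← Finset.sum_filter]
    congr 1
    ext b
    simp only [Finset.mem_filter]
    exact ⟨fun hb => ⟨hST c hc hb, hb⟩, fun hb => hb.2⟩
  rw [Finset.sum_congr rfl h1, Finset.sum_comm, Finset.mul_sum]
  refine Finset.sum_le_sum fun b hb => ?_
  rw [← Finset.sum_filter, Finset.sum_const, nsmul_eq_mul]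
  exact mul_le_mul_of_nonneg_right (by exact_mod_cast hν b hb) (hg b hb)

variable (L : ℕ) {V₀ : Site d → Fin d → 𝔸ˣ} (hV₀ : ∀ x κ, V₀ x κ ∈ U1 𝔸) (hL : 1 ≤ L) {ε : ℝ} (hε0 : 0 ≤ ε) (hε : ε ≤ 1 / 8)

include hV₀ hL hε0 hε in
/-- **THE (R-M) LETTER's SHAPE AT `k = 1`**: over a finite family `Λ` of coarse bonds `c = ⟨q_c, q_c + Le_{κ_c}⟩`, each with block-loop
regularity `≤ ε`, whose box bond sets `bondsIn q_c (bondHi L q_c κ_c)` lie in a finite bond set `T` with multiplicity `≤ ν`: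
`Σ_{c∈Λ} ‖L(Q(V₀)A)_c − L·(Q₀A)_c‖² ≤ (50(d+1)εL)²·ν·Σ_{b∈T} ‖A_b‖²` — `…AveragedCurlFormSplit`'s `hE` with `c_E := (50(d+1)εL)²ν` before
normalisation. [folklore] -/
theorem sum_normSq_remainder_le {ι : Type*} (Λ : Finset ι) (cq : ι → Site d) (cκ : ι → Fin d)
    (hW : ∀ c ∈ Λ, ∀ r : Fin d → Fin L, ‖((Wcx L V₀ (cq c) (cκ c) (boxVec L r) : 𝔸ˣ) : 𝔸) - 1‖ ≤ ε)
    (T : Finset (Site d × Fin d)) (hST : ∀ c ∈ Λ, bondsIn (cq c) (bondHi L (cq c) (cκ c)) ⊆ T) {ν : ℕ}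
    (hν : ∀ b ∈ T, (Λ.filter fun c => b ∈ bondsIn (cq c) (bondHi L (cq c) (cκ c))).card ≤ ν)
    (A : Site d → Fin d → 𝔸) :
    ∑ c ∈ Λ, ‖linQcov L V₀ A (cq c) (cκ c) - (L : ℝ) • Q0cov L V₀ A (cq c) (cκ c)‖ ^ 2
      ≤ (50 * (d + 1) * ε * L) ^ 2 * ν * ∑ b ∈ T, ‖A b.1 b.2‖ ^ 2 := by
  classical
  have h1 : ∑ c ∈ Λ, ‖linQcov L V₀ A (cq c) (cκ c) - (L : ℝ) • Q0cov L V₀ A (cq c) (cκ c)‖ ^ 2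
      ≤ ∑ c ∈ Λ, (50 * (d + 1) * ε * L) ^ 2 * ∑ b ∈ bondsIn (cq c) (bondHi L (cq c) (cκ c)), ‖A b.1 b.2‖ ^ 2 :=
    Finset.sum_le_sum fun c hc => normSq_remainder_le_local L hV₀ hL (cq c) (cκ c) hε0 hε (hW c hc) A
  have h2 := sum_sum_filter_le Λ (fun c => bondsIn (cq c) (bondHi L (cq c) (cκ c))) T hST hν
    (fun b => ‖A b.1 b.2‖ ^ 2) (fun b _ => sq_nonneg _)
  rw [← Finset.mul_sum] at h1
  calc _ ≤ (50 * (d + 1) * ε * L) ^ 2 * ∑ c ∈ Λ, ∑ b ∈ bondsIn (cq c) (bondHi L (cq c) (cκ c)), ‖A b.1 b.2‖ ^ 2 := h1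
    _ ≤ (50 * (d + 1) * ε * L) ^ 2 * (ν * ∑ b ∈ T, ‖A b.1 b.2‖ ^ 2) := mul_le_mul_of_nonneg_left h2 (sq_nonneg _)
    _ = (50 * (d + 1) * ε * L) ^ 2 * ν * ∑ b ∈ T, ‖A b.1 b.2‖ ^ 2 := by ring

end Family

/-! ## §4 `ε` from the plaquette regularity (109) -/

section Plaquettes

variable (L : ℕ) {V₀ : Site d → Fin d → 𝔸ˣ} (hV₀ : ∀ x κ, V₀ x κ ∈ U1 𝔸) (hL : 1 ≤ L) (q : Site d) (κ : Fin d)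

include hV₀ hL in
/-- **§2 UNDER (109)**: if `‖V₀(∂p) − 1‖ ≤ α₀` for all plaquettes with `512(d+1)(d+4)L²α₀ ≤ 1` and `16(d+1)(d+4)L²α₀ ≤ ⅛`, then for `‖A_b‖ ≤ a`
on the bonds of `B(c₋) ∪ B(c₊)`: `‖L(Q(V₀)A)_c − L·(Q₀A)_c‖ ≤ 50(d+1)·(16(d+1)(d+4)L²α₀)·L·a` (`B7Prop2Explicit.norm_Wcx_sub_one_le` BY NAME
for the block loops). [folklore] -/
theorem norm_remainder_le_local_of_plaquettes {α₀ : ℝ} (hα₀ : 0 ≤ α₀)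
    (hsmall : 512 * (d + 1) * (d + 4) * (L : ℝ) ^ 2 * α₀ ≤ 1)
    (hsmall' : 16 * (d + 1) * (d + 4) * (L : ℝ) ^ 2 * α₀ ≤ 1 / 8)
    (h44 : ∀ (x : Site d) (κ κ' : Fin d), κ ≠ κ' → ‖((hol V₀ x (plaqWord κ κ') : 𝔸ˣ) : 𝔸) - 1‖ ≤ α₀)
    (A : Site d → Fin d → 𝔸) {a : ℝ} (ha : 0 ≤ a)
    (hA : ∀ x κ', InBox q (bondHi L q κ) x → InBox q (bondHi L q κ) (x + e κ') → ‖A x κ'‖ ≤ a) :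
    ‖linQcov L V₀ A q κ - (L : ℝ) • Q0cov L V₀ A q κ‖
      ≤ 50 * (d + 1) * (16 * (d + 1) * (d + 4) * (L : ℝ) ^ 2 * α₀) * L * a := by
  have hWε : ∀ r : Fin d → Fin L,
      ‖((Wcx L V₀ q κ (boxVec L r) : 𝔸ˣ) : 𝔸) - 1‖ ≤ 16 * (d + 1) * (d + 4) * (L : ℝ) ^ 2 * α₀ := fun r =>
    (B7Prop2Explicit.norm_Wcx_sub_one_le L hL V₀ hV₀ hα₀ hsmall h44 q κ r).trans (le_of_eq (by ring))
  exact norm_remainder_le_local L hV₀ hL q κ (by positivity) hsmall' hWε A ha hA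

end Plaquettes

/-! ## §5 The box multiplicity `ν = 2d` BY NAME, and the letter at `k = 1` BY VALUE

For the coarse bonds `c = ⟨y, y + e_κ⟩` of the `L`-lattice (fine base point `loK L 1 y = L·y`, box `[L·y, bondHiK L 1 y κ]`) a fine bond lies in
the box of at most `2d` of them: `B7Prop5Flat.mem_nearBonds_of_bondIn` ∕ `card_nearBonds_le` BY NAME (print's `2d` of (142)). -/

section Lattice

omit [NormedAlgebra ℂ 𝔸] [NormOneClass 𝔸] [CompleteSpace 𝔸] [NormedRing 𝔸] in
/-- the one-step box of `B7Prop1Local` in its two spellings: `bondHi L (L·y) κ = bondHiK L 1 y κ`. [folklore] -/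
theorem bondHi_loK_one (L : ℕ) (y : Site d) (κ : Fin d) :
    bondHi L (B7Prop1Local.loK L 1 y) κ = B7Prop1Local.bondHiK L 1 y κ := by
  funext i
  simp [bondHi, B7Prop1Local.bondHiK, B7Prop1Local.loK, pow_one]

omit [NormedAlgebra ℂ 𝔸] [NormOneClass 𝔸] [CompleteSpace 𝔸] [NormedRing 𝔸] in
/-- **`ν = 2d`**: among any finite family `Λ` of coarse bonds `(y, κ)` of the `L`-lattice, at most `2d` have a given fine bond `b` in their box
`B(c₋) ∪ B(c₊)` (`B7Prop5Flat.mem_nearBonds_of_bondIn` + `card_nearBonds_le` BY NAME, level `j = 1`). [folklore] -/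
theorem card_filter_box_le (L : ℕ) (hL : 1 ≤ L) (Λ : Finset (Site d × Fin d)) (b : Site d × Fin d) :
    (Λ.filter fun c => b ∈ bondsIn (B7Prop1Local.loK L 1 c.1) (bondHi L (B7Prop1Local.loK L 1 c.1) c.2)).card ≤ 2 * d := by
  calc _ ≤ (B7Prop5Flat.nearBonds (B7Prop5Flat.blockPt L 1 b.1)).card := by
        refine Finset.card_le_card fun c hc => ?_
        rw [Finset.mem_filter, bondHi_loK_one] at hc
        exact B7Prop5Flat.mem_nearBonds_of_bondIn L hL 1 (mem_bondsIn.mp hc.2)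
    _ ≤ 2 * d := B7Prop5Flat.card_nearBonds_le _

variable (L : ℕ) {V₀ : Site d → Fin d → 𝔸ˣ} (hV₀ : ∀ x κ, V₀ x κ ∈ U1 𝔸) (hL : 1 ≤ L) {ε : ℝ} (hε0 : 0 ≤ ε) (hε : ε ≤ 1 / 8)

include hV₀ hL hε0 hε in
/-- **THE (R-M) LETTER AT `k = 1` BY VALUE** (up to the normalisations): over any finite family `Λ` of coarse bonds `c = ⟨y, y + e_κ⟩` of the
`L`-lattice with block-loop regularity `≤ ε ≤ ⅛`, and any finite fine-bond set `T` containing their boxes' bonds: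
`Σ_{c∈Λ} ‖L(Q(V₀)A)_c − L·(Q₀A)_c‖² ≤ (50(d+1)εL)²·2d·Σ_{b∈T} ‖A_b‖²` — §3 with `ν := 2d` discharged. [folklore] -/
theorem sum_normSq_remainder_le_lattice (Λ : Finset (Site d × Fin d))
    (hW : ∀ c ∈ Λ, ∀ r : Fin d → Fin L, ‖((Wcx L V₀ (B7Prop1Local.loK L 1 c.1) c.2 (boxVec L r) : 𝔸ˣ) : 𝔸) - 1‖ ≤ ε)
    (T : Finset (Site d × Fin d))
    (hST : ∀ c ∈ Λ, bondsIn (B7Prop1Local.loK L 1 c.1) (bondHi L (B7Prop1Local.loK L 1 c.1) c.2) ⊆ T)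
    (A : Site d → Fin d → 𝔸) :
    ∑ c ∈ Λ, ‖linQcov L V₀ A (B7Prop1Local.loK L 1 c.1) c.2 - (L : ℝ) • Q0cov L V₀ A (B7Prop1Local.loK L 1 c.1) c.2‖ ^ 2
      ≤ (50 * (d + 1) * ε * L) ^ 2 * ((2 * d : ℕ) : ℝ) * ∑ b ∈ T, ‖A b.1 b.2‖ ^ 2 :=
  sum_normSq_remainder_le L hV₀ hL hε0 hε Λ (fun c => B7Prop1Local.loK L 1 c.1) (fun c => c.2) hW T hST
    (fun b _ => card_filter_box_le L hL Λ b) A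

end Lattice

end Summit.QuantumFields.BalabanUV.T4Continuum.NE7b.OneStepAveragingRemainder

end
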